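import Summits.BirchSwinnertonDyer.BirchSwinnertonDyer.Theorems.ByReductionTypeAtTwoSupersingularFlatPTLimitOfOrth
import Summits.BirchSwinnertonDyer.BirchSwinnertonDyer.Theorems.ByReductionTypeAtTwoSupersingularFlatOrthogonality
import Summits.BirchSwinnertonDyer.BirchSwinnertonDyer.Theorems.ByReductionTypeAtTwoSupersingularFlatKerDelta
import Summits.BirchSwinnertonDyer.BirchSwinnertonDyer.Theorems.ByReductionTypeAtTwoSupersingularFlatExactAssembly
import Summits.BirchSwinnertonDyer.BirchSwinnertonDyer.Theorems.ByReductionTypeAtTwoSupersingularFlatToXLinear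
import Summits.BirchSwinnertonDyer.BirchSwinnertonDyer.Theorems.ByReductionTypeAtTwoSupersingularFlatPairFun
import Summits.BirchSwinnertonDyer.BirchSwinnertonDyer.Theorems.ByReductionTypeAtTwoSupersingularFlatColemanLinearOfTraces
import Summits.BirchSwinnertonDyer.BirchSwinnertonDyer.Theorems.ByReductionTypeAtTwoSupersingularFlatEulerCharRat
import Summits.BirchSwinnertonDyer.BirchSwinnertonDyer.Theorems.ByReductionTypeAtTwoSupersingularTowerTorsionTwo
import Summits.BirchSwinnertonDyer.BirchSwinnertonDyer.Theorems.ByReductionTypeAtTwoSupersingularFlatLocalDataOfHondaSystem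
import Summits.BirchSwinnertonDyer.BirchSwinnertonDyer.Theorems.ByReductionTypeAtTwoSupersingularFlatZetaPackage
import Literature.NumberTheory.EllipticCurves.Kato2004.IwasawaCohomologyExistsProofs
import Literature.NumberTheory.EllipticCurves.Kato2004.IwasawaInvolutionTwistProofs
import Literature.NumberTheory.EllipticCurves.KatoFineSelmerDualProofs
import Literature.NumberTheory.EllipticCurves.Sprung2012.SharpFlatSelmerDualRestrictionProofs
import HarnessLib

/-!
# Route `ByReductionTypeAtTwo` (rung K4), crux `SupersingularRankZeroAtTwo` (item stmt-BirchSwinnertonDyer-19097), line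
# `odd_blind_package` v2.20, stub 2/5 `stub_flatPackage` — **THE F1♭ FOLD**: conjunct (8)'s ♭ Poitou–Tate exactness
# `Function.Exact loc toX ∧ Function.Exact toX δ` is DISCHARGED BY NAME from the hands' tree theorems, so that what the stub
# still has to supply is the ♭ ZETA PACKAGE (Honda system + F3 + ZL2 in the Coleman/`pairFun` currency) — and from it the full
# (8)-block of `FlatCKPackageAtTwo` (v2.20 (B)-form: conjunct (8) PROVIDES the Honda system) follows in the kernel
# (cell `bsd-2adic`, seat `bsd-2adic-ss-1` GEN 26 = LEAD of 19097; `--supports 19097`, helper)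

HONEST FRAMING (D-0054): THEOREMS ONLY — no definition, no named fact, no instance, no notation, no `sorry`.  GLUE file: it
proves nothing arithmetic beyond composing landed theorems.  It closes NO stub by itself; 19097 stays OPEN on its registered stubs;
nothing is booked on the class board; BSD₂ is proved for no supersingular curve and BSD for no curve by any of this; typed ≠ proved.

## What and why

Conjunct (8) of the registered line (v2.19 ad3ba3fc; (B)-form certified by the pen, RC-835) asks, for every curve of the crux, the
cyclotomic `(κ, γ)`, `v ∋ 2`, a local lift `g` of `γ`, for a Honda system `(cneg, c)` at two AND, for every newform/period/Sprung-pair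
datum and every ♭ dual Selmer datum `D` (key `γ⁻¹`), for `∃ I Y P loc toX δ Z G, Exact loc toX ∧ Exact toX δ ∧ F3a ∧ F3b ∧ ZL2`.
The two exactness clauses (F1♭ = the ♭ Poitou–Tate sequence `𝐇¹_Γ →loc Λ →toX X♭ →δ X₀`) are now tree theorems for the
displayed witnesses `P := ⊤`, `loc := Col♭ ∘ₗ pairFun`, `toX :=` the contract map, `δ :=` the transpose of `Sel₀ ≤ Sel♭`:
(⊆₁) T-ORTH `SSFlatPT.toX_snd_apply_eq_zero` (p833066) · (⊇₁) T-LIM `SSFlatPT.exists_snd_coleman_apply_eq_of_orth` (p834233) through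
`SSFlatPT.exists_snd_apply_eq_of_toX_eq_zero` (p833046) · (⊆₂) clause (δ̄) of `SSFlatPackage.exists_flatToXLinearMap_of_mul_eq_one`
(p831519) · (⊇₂) T-δ `SSFlatPT.exists_toX_apply_eq_of_transpose_eq_zero` (p833047) · assembly `SSFlatPT.exists_exact_and_exact_of_inclusions`
(p833046).  Their displayed inputs are tree theorems on the habitat: the pin `I` (`Kato2004.nonempty_iwasawaH1Data_holds`), the
`Λ`-linear localisation `L = pairFun` with its Tate-pairing residues (`SSFlatPackage.exists_linearMap_pairFun_tatePairing`, p830262),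
the `Λ`-linear joint Coleman family `J` (`OddBlindNF.exists_linearMap_isColemanPair_of_traces`), `Col♭` onto
(`SSFlatEC.flat_surjective_rat` + `IsColemanPair.unique`), no `2`-torsion in `E(ℚ_∞·ℚ_v)` (`SSFlatEC.eq_zero_of_mem_localTowerPointsOfEmb_of_two_nsmul`),
the fine datum of key `γ⁻¹` (`Kato2004.fineSelmerDualData_exists_involTwist`) and its transpose
(`Sprung2012.SharpFlatSelmerDualData.exists_linearMap_toFineDual'`), and the Honda clauses (levels, traces, (INJ)/(SAT) transported by
`SSFlatLocalData.inj_of_inj_zsmul` / `sat_of_sat_zsmul`).  Hence the honest residual statement of stub 2 is the **♭ zeta package**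
(the hypothesis `hZ` below, = the v2.20 text of `FlatZetaPackageAtTwo` VERBATIM): for every `g`, a Honda system `(cneg, c)` such that
for every newform datum and EVERY pin `I`, `pairFun`-pinned `L` and Coleman-pinned `J` there are `Z ≤ 𝐇¹` and `G ∈ Col♭(L Z)` with
`ι G = C(ϖ)·ι L♭` (F3) and the zeta line in local form (ZL2).  The theorem below derives the (B)-form (8)-block from it — its conclusion is
the v2.20 text of `FlatCKPackageAtTwo` VERBATIM — so the line file's glue is one `exact`.

## What is proved
* ★★ `SSFlatFold.flatCKPackage_of_flatZetaPackage` : `‹FlatZetaPackageAtTwo text› → ‹FlatCKPackageAtTwo (B)-form text›`.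

References: [Sprung2012] F. Sprung, J. Number Theory 132 (2012), Def. 7.9, 7.11 (p. 1503), Prop. 7.19 (p. 1505), Thm. 7.14, 7.16;
[Kobayashi2003] S. Kobayashi, Invent. Math. 152 (2003), (7.17)–(7.21) (p. 12), (8.23); [Kato2004Asterisque] K. Kato, Astérisque 295
(2004), §12.2 (p. 220), Thm. 12.5, §13.8–13.14 (pp. 228–234), §17.13 (p. 279); [GreenbergLNM1716] R. Greenberg, LNM 1716, §4 pp. 121–122;
[Greenberg1989] pp. 101–102.
-/

set_option autoImplicit false
-- the Theorems namespace of this sub repeats the summit name by design (D-0017 nested layout)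
set_option linter.dupNamespace false

noncomputable section

open scoped Classical MatrixGroups ModularForm NumberField
open NumberField IsDedekindDomain CongruenceSubgroup WeierstrassCurve PowerSeries
open Literature.NumberTheory.EllipticCurves Literature.NumberTheory.EllipticCurves.IwasawaDual
  Literature.NumberTheory.EllipticCurves.Sprung2012 Literature.NumberTheory.EllipticCurves.Sprung2017
  Literature.NumberTheory.EllipticCurves.ModularForms
  Literature.NumberTheory.EllipticCurves.Rank1Residual
  Literature.NumberTheory.EllipticCurves.Kobayashi2003 Literature.NumberTheory.GaloisRepresentations ZpExtension
open Summit.BirchSwinnertonDyer.Rank1Residual Summit.BirchSwinnertonDyer.Rank1Residual.Supersingular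

namespace Summit.BirchSwinnertonDyer.BirchSwinnertonDyer.Theorems

namespace SSFlatFold

/-- ★★ **THE F1♭ FOLD: the ♭ zeta package at `2` gives the (B)-form (8)-block of `FlatCKPackageAtTwo`.**  Hypothesis = the v2.20 text of
`FlatZetaPackageAtTwo` (for every local lift `g` of `γ`: a Honda system `(cneg, c)` at two, and for every newform / period / Sprung-pair datum,
every pin `I : 𝐇¹_Γ(T₂W)`, every `Λ`-linear `L` with the Tate-pairing residues of `pairFun` and every `Λ`-linear `J` carrying the Coleman values
of `c`: `∃ Z G`, F3a `G ∈ Col♭(L Z)` ∧ F3b `ι G = C(ϖ)·ι L♭` ∧ ZL2).  Conclusion = the v2.20 text of `FlatCKPackageAtTwo` ((B)-form: `∀ g, hg →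
∃ cneg c, IsHondaSystemAtTwo … ∧ ∀ f ϖ Ls Lf D …, ∃ I Y P loc toX δ Z G, Exact loc toX ∧ Exact toX δ ∧ F3a ∧ F3b ∧ ZL2`).  PROOF: the pin `I`,
`L := pairFun`, the joint Coleman family `J`, `Col♭` onto, the contract `toX`, the `γ⁻¹`-keyed fine datum `Y` and the transpose `δ` are tree
constructions; the four inclusions are T-ORTH, T-LIM, (δ̄), T-δ; `SSFlatPT.exists_exact_and_exact_of_inclusions` packages them on `P := ⊤` with
`(loc x : Λ) = Col♭(L x)`, which also transports F3a.  No arithmetic of its own.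
[cite: Sprung2012, Def. 7.9, Def. 7.11 (p. 1503), Prop. 7.19 (p. 1505)] [cite: Kobayashi2003, (7.17)–(7.21) (p. 12)]
[cite: Kato2004Asterisque, §12.2 (p. 220), §13.12–13.14 (pp. 231–234), §17.13 (p. 279)] [cite: GreenbergLNM1716, §4 pp. 121–122] -/
theorem flatCKPackage_of_flatZetaPackage
    (hZ : ∀ (W : WeierstrassCurve ℚ) [W.IsElliptic] [W.IsGloballyMinimal],
      ¬ W.HasCM → W.analyticRank = 0 → GoodSS W 2 →
      ∀ (κ : ZpExtension ℚ 2) (γ : Field.absoluteGaloisGroup ℚ) (hκ : κ.IsCyclotomic),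
        κ.IsTopGenerator γ → IsCyclotomicVariable 2 γ →
      ∀ (v : HeightOneSpectrum (𝓞 ℚ)), (2 : 𝓞 ℚ) ∈ v.asIdeal →
      ∀ (g : Field.absoluteGaloisGroup (v.adicCompletion ℚ))
        (hg : κ.IsTopGenerator (resGalOfEmb (closureEmb (K := ℚ) (v.adicCompletion ℚ)) g)),
        ∃ (cneg : localPoints W (v.adicCompletion ℚ)) (c : ℕ → localPoints W (v.adicCompletion ℚ)),
        Summit.BirchSwinnertonDyer.Rank1Residual.F1Sign2.IsHondaSystemAtTwo κ
          (closureEmb (K := ℚ) (v.adicCompletion ℚ)) W (W.frobeniusTrace 2) g cneg c ∧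
        (∀ [NeZero (W.conductorNorm ℤ)] (f : CuspForm (Gamma0 (W.conductorNorm ℤ)) 2),
            IsNewformOf W f → ∀ (ϖ : ℚ), (ϖ : ℝ) * W.realPeriodRat = plusPeriod f →
          ∀ (Ls Lf : IwasawaAlgebra 2), IsSprungPair f 2 (W.frobeniusTrace 2) Ls Lf →
          ∀ [ContinuousSMul ℤ_[2] (W.tateModule 2)] [Module.Free ℤ_[2] (W.tateModule 2)]
            [Module.Finite ℤ_[2] (W.tateModule 2)] (I : Kato2004.IwasawaH1Data W 2 κ γ)
            (L : letI := moduleOfGenerator κ (closureEmb (K := ℚ) (v.adicCompletion ℚ)) W hg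
              I.H →ₗ[IwasawaAlgebra 2] (localTowerPointsOfEmb κ (closureEmb (K := ℚ) (v.adicCompletion ℚ)) W →+ ℤ_[2])),
            (∀ (x : I.H) (n k : ℕ) (Q : localPoints W (v.adicCompletion ℚ))
                (hQ : Q ∈ localLayerPointsOfEmb κ (closureEmb (K := ℚ) (v.adicCompletion ℚ)) W n),
                PadicInt.toZModPow k (L x ⟨Q, localLayerPointsOfEmb_le_localTowerPointsOfEmb κ _ W n hQ⟩) =
                  CyclotomicLayer.tatePairingPk W κ v n k (I.proj n x) ⟨Q, hQ⟩) →
          ∀ (J : letI := moduleOfGenerator κ (closureEmb (K := ℚ) (v.adicCompletion ℚ)) W hg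
              (localTowerPointsOfEmb κ (closureEmb (K := ℚ) (v.adicCompletion ℚ)) W →+ ℤ_[2]) →ₗ[IwasawaAlgebra 2]
                IwasawaAlgebra 2 × IwasawaAlgebra 2),
            (∀ w, IsColemanPair κ (closureEmb (K := ℚ) (v.adicCompletion ℚ)) W (W.frobeniusTrace 2) g c w (J w).1 (J w).2) →
            ∃ (Z : Submodule (IwasawaAlgebra 2) I.H) (G : IwasawaAlgebra 2),
              (∃ z ∈ Z, (J (L z)).2 = G) ∧
              iwasawaToPowerSeries 2 G = PowerSeries.C (ϖ : ℚ_[2]) * iwasawaToPowerSeries 2 Lf ∧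
              (∃ s₀ : I.H, Z = Submodule.span (IwasawaAlgebra 2) {s₀} ∧
                ∀ 𝔭 : PrimeSpectrum (IwasawaAlgebra 2), 𝔭.asIdeal.height = 1 →
                  PowerSeries.C (2 : ℤ_[2]) ∉ 𝔭.asIdeal →
                  ∃ (M : IwasawaAlgebra 2) (s : I.H), M ∉ 𝔭.asIdeal ∧
                    Literature.NumberTheory.EllipticCurves.Kato2004.IsEulerSystemClassTwo W hκ I s ∧ s ≠ 0 ∧
                    M • s₀ = s))) :
    ∀ (W : WeierstrassCurve ℚ) [W.IsElliptic] [W.IsGloballyMinimal],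
      ¬ W.HasCM → W.analyticRank = 0 → GoodSS W 2 →
      ∀ (κ : ZpExtension ℚ 2) (γ : Field.absoluteGaloisGroup ℚ) (hκ : κ.IsCyclotomic),
        κ.IsTopGenerator γ → IsCyclotomicVariable 2 γ →
      ∀ (v : HeightOneSpectrum (𝓞 ℚ)), (2 : 𝓞 ℚ) ∈ v.asIdeal →
      ∀ (g : Field.absoluteGaloisGroup (v.adicCompletion ℚ)),
        κ.IsTopGenerator (resGalOfEmb (closureEmb (K := ℚ) (v.adicCompletion ℚ)) g) →
        ∃ (cneg : localPoints W (v.adicCompletion ℚ)) (c : ℕ → localPoints W (v.adicCompletion ℚ)),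
        Summit.BirchSwinnertonDyer.Rank1Residual.F1Sign2.IsHondaSystemAtTwo κ
          (closureEmb (K := ℚ) (v.adicCompletion ℚ)) W (W.frobeniusTrace 2) g cneg c ∧
        (∀ [NeZero (W.conductorNorm ℤ)] (f : CuspForm (Gamma0 (W.conductorNorm ℤ)) 2),
            IsNewformOf W f → ∀ (ϖ : ℚ), (ϖ : ℝ) * W.realPeriodRat = plusPeriod f →
          ∀ (Ls Lf : IwasawaAlgebra 2), IsSprungPair f 2 (W.frobeniusTrace 2) Ls Lf →
          ∀ (D : SharpFlatSelmerDualData W κ γ⁻¹ (closureEmb (K := ℚ) (v.adicCompletion ℚ))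
              (W.frobeniusTrace 2) g c .flat) [ContinuousSMul ℤ_[2] (W.tateModule 2)]
              [Module.Free ℤ_[2] (W.tateModule 2)] [Module.Finite ℤ_[2] (W.tateModule 2)],
            ∃ (I : Kato2004.IwasawaH1Data W 2 κ γ) (Y : W.FineSelmerDualData κ γ⁻¹)
              (P : Submodule (IwasawaAlgebra 2) (IwasawaAlgebra 2))
              (loc : I.H →ₗ[IwasawaAlgebra 2] P) (toX : P →ₗ[IwasawaAlgebra 2] D.X)
              (δ : D.X →ₗ[IwasawaAlgebra 2] Y.X) (Z : Submodule (IwasawaAlgebra 2) I.H)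
              (G : IwasawaAlgebra 2),
              Function.Exact loc toX ∧ Function.Exact toX δ ∧
              G ∈ Submodule.map (P.subtype ∘ₗ loc) Z ∧
              iwasawaToPowerSeries 2 G = PowerSeries.C (ϖ : ℚ_[2]) * iwasawaToPowerSeries 2 Lf ∧
              (∃ s₀ : I.H, Z = Submodule.span (IwasawaAlgebra 2) {s₀} ∧
                ∀ 𝔭 : PrimeSpectrum (IwasawaAlgebra 2), 𝔭.asIdeal.height = 1 →
                  PowerSeries.C (2 : ℤ_[2]) ∉ 𝔭.asIdeal →
                  ∃ (M : IwasawaAlgebra 2) (s : I.H), M ∉ 𝔭.asIdeal ∧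
                    Literature.NumberTheory.EllipticCurves.Kato2004.IsEulerSystemClassTwo W hκ I s ∧ s ≠ 0 ∧
                    M • s₀ = s)) := by
  intro W _ _ hCM hr hss κ γ hκ hγ hγ' v hv g hg
  obtain ⟨cneg, c, hHonda, hF⟩ := hZ W hCM hr hss κ γ hκ hγ hγ' v hv g hg
  refine ⟨cneg, c, hHonda, ?_⟩
  intro _ f hf ϖ hϖ Ls Lf hSP D _ _ _
  -- the Honda clauses: levels, bottom value, traces, (INJ)/(SAT) at `cneg`
  obtain ⟨hcneg, hc, hc0, -, hTr, hinj, hsat, -⟩ := id hHonda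
  have hap : (2 : ℤ) ∣ W.frobeniusTrace 2 := hss.2
  have hodd : ¬ (2 : ℤ) ∣ W.frobeniusTrace 2 ^ 2 - 2 * W.frobeniusTrace 2 - 1 :=
    SSFlatLocalData.not_two_dvd_sq_sub _
      (Summit.BirchSwinnertonDyer.Rank1Residual.Supersingular.frobeniusTrace_two_eq_zero_or W hss.1 hss.2)
  have hinj' := SSFlatLocalData.inj_of_inj_zsmul W _ hcneg hodd hc0 hinj
  have hsat' := SSFlatLocalData.sat_of_sat_zsmul W _ hcneg hodd hc0 hsat
  -- no `2`-torsion in `E(ℚ_∞·ℚ_v)` (good supersingular `2`)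
  have hnt : ∀ P ∈ localTowerPointsOfEmb κ (closureEmb (K := ℚ) (v.adicCompletion ℚ)) W, 2 • P = 0 → P = 0 :=
    fun P hP h2 ↦ SSFlatEC.eq_zero_of_mem_localTowerPointsOfEmb_of_two_nsmul W hss κ hv _ hP h2
  letI := moduleOfGenerator κ (closureEmb (K := ℚ) (v.adicCompletion ℚ)) W hg
  -- the pin `I`, the localisation `L = pairFun`, the joint Coleman family `J`
  obtain ⟨I⟩ := Literature.NumberTheory.EllipticCurves.Kato2004.nonempty_iwasawaH1Data_holds W 2 κ γ hκ hγ
  obtain ⟨-, L, -, -, -, -, hL⟩ := SSFlatPackage.exists_linearMap_pairFun_tatePairing W κ v hκ hv hγ hg I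
  obtain ⟨J, hJ⟩ := OddBlindNF.exists_linearMap_isColemanPair_of_traces hg hap hc hTr
  -- `Col♭` is onto `Λ`
  have hsurj : ∀ f' : IwasawaAlgebra 2, ∃ w, (J w).2 = f' := fun f' ↦ by
    obtain ⟨z, Ls', hz⟩ := SSFlatEC.flat_surjective_rat W 2 κ hv (closureEmb (K := ℚ) (v.adicCompletion ℚ)) hnt hap hg
      hc hTr hinj' hsat' f'
    exact ⟨z, (IsColemanPair.unique κ _ W hap (hJ z) hz).2⟩
  -- the stub's ♭ zeta package at `(I, L, J)`
  obtain ⟨Z, G, ⟨z, hz, hzG⟩, hF3b, hZL⟩ := hF f hf ϖ hϖ Ls Lf hSP I L hL J hJ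
  -- the contract `toX` with (V̄) and (δ̄)
  obtain ⟨toX₀, hV, -, hδbar⟩ :=
    SSFlatPackage.exists_flatToXLinearMap_of_mul_eq_one W κ v hγ (mul_inv_cancel γ) hg hap J hJ hsurj D
  -- the fine datum of key `γ⁻¹` and the transpose `δ` of `Sel₀ ≤ Sel♭`
  obtain ⟨Y₀⟩ := W.nonempty_fineSelmerDualData κ hγ
  obtain ⟨Y, -, -, -⟩ := Literature.NumberTheory.EllipticCurves.Kato2004.fineSelmerDualData_exists_involTwist
    (mul_inv_cancel γ) Y₀
  obtain ⟨δ, -, hδ⟩ := SharpFlatSelmerDualData.exists_linearMap_toFineDual' W κ _ _ D Y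
  -- the four inclusions
  have h₁ : ∀ x : I.H, toX₀ (((LinearMap.snd (IwasawaAlgebra 2) (IwasawaAlgebra 2) (IwasawaAlgebra 2)) ∘ₗ J ∘ₗ L) x) = 0 :=
    fun x ↦ SSFlatPT.toX_snd_apply_eq_zero W κ v hκ hv I L hL (fun w ↦ (J w).2) D toX₀ hV x
  have h₂ : ∀ f' : IwasawaAlgebra 2, toX₀ f' = 0 →
      ∃ x : I.H, ((LinearMap.snd (IwasawaAlgebra 2) (IwasawaAlgebra 2) (IwasawaAlgebra 2)) ∘ₗ J ∘ₗ L) x = f' :=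
    fun f' hf' ↦ SSFlatPT.exists_snd_apply_eq_of_toX_eq_zero W κ v J L D toX₀ hV hsurj
      (SSFlatPT.exists_snd_coleman_apply_eq_of_orth W κ v hκ hv hg hap hc hTr J hJ I L hL) f' hf'
  have h₃ : ∀ f' : IwasawaAlgebra 2, δ (toX₀ f') = 0 := hδbar Y δ.toAddMonoidHom hδ
  have h₄ : ∀ y : D.X, δ y = 0 → ∃ f' : IwasawaAlgebra 2, toX₀ f' = y := fun y hy ↦ by
    obtain ⟨w, hw⟩ := SSFlatPT.exists_toX_apply_eq_of_transpose_eq_zero W κ v hv hg hnt (fun w ↦ (J w).2) D toX₀ hV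
      Y δ.toAddMonoidHom hδ y hy
    exact ⟨_, hw⟩
  obtain ⟨P, loc, toX, hA, hB, -, hloc, -⟩ :=
    SSFlatPT.exists_exact_and_exact_of_inclusions _ toX₀ δ h₁ h₂ h₃ h₄
  refine ⟨I, Y, P, loc, toX, δ, Z, G, hA, hB, ?_, hF3b, hZL⟩
  exact Submodule.mem_map.2 ⟨z, hz, by rw [LinearMap.comp_apply, Submodule.subtype_apply, hloc, ← hzG]; rfl⟩

end SSFlatFold

end Summit.BirchSwinnertonDyer.BirchSwinnertonDyer.Theorems

end
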